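import Literature.Probability.RandomPlanarGeometry.SLESchrammMartingale
import HarnessLib

/-!
# Harmonic functions of the SLE slope diffusion give martingales `F(w_{t∧ρₙ})`

Topic `Probability/RandomPlanarGeometry`; one theorem. For the centred SLE_κ flow
`z_t = g_t(z) − √κ B_t = x_t + i y_t` of a point `z ∈ ℍ` and its slope `w_t = x_t/y_t`
(Rohde–Schramm (2005), proof of Lemma 6.3, p. 904; Schramm (2001), proof of Thm. 2:
`dw = −dW/y + 4w dt/|z|²`, a time change of the diffusion `dw = −dW̃ + 4w du/(w² + 1)`), and a
function `F ∈ C²(ℝ)` with bounded derivative solving the generator equation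

  `(κ/2) F'' + (4w/(1 + w²)) F' = 0`

("`h(w_u)` is a local martingale … `h` satisfies `(κ/2) h'' + (4w/(w² + 1)) h' = 0`", Schramm
(2001), p. 3), the process `F(w_t)` stopped at the localizing time `ρₙ = slePointLocTime κ z n` of
`SLEPointFlow.lean` is a martingale of the raw Brownian filtration under the pre-Wiener measure
(`martingale_stoppedProcess_comp_cotArg_of_ode`). This is the tree's
`martingale_schrammObsStopped_sle` (`SLESchrammMartingale.lean`: `κ = 8/3`, `F = h = schrammH`)
with the special function replaced by a hypothesis: the proof is the same Itô computation —
`x^{ρₙ}` is an Itô process (`isItoProcess_stoppedProcess_slePointRe`), `w = x · (1/y)` by the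
product rule (`IsItoProcess.mul_timeIntegral`), `F(w)` by Itô's formula
(`ito_formula_itoProcess_ae_holds`), the drift `y⁻²[(κ/2) F'' + (4w/(1 + w²)) F'](w)` vanishes
(`rsObservable_itoDrift_eq_zero` with `a = 0`), and the Itô integrand `−√κ F'(w)/y` is bounded on
`[0, ρₙ]` (`|F'| ≤ C₁`, `y ≥ Im z/(n+2)`), so `F(w) = F(w₀) + ∫ … dB` is a true martingale.
Used with Schramm's scale function `f(w) = ∫₀ʷ (1 + v²)^{−4/κ} dv = w ₂F₁(½, 4/κ; 3/2; −w²)`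
(`SchrammScaleFunction.lean`) to prove the slope dichotomy `Schramm2001_slope_dichotomy` for all
`κ ∈ (0, 8)`.

## References

* O. Schramm, *A percolation formula*, Electron. Comm. Probab. 6 (2001), proof of Thm. 2.
* S. Rohde, O. Schramm, *Basic properties of SLE*, Ann. of Math. 161 (2005), proof of Lemma 6.3.
* D. Revuz, M. Yor, *Continuous Martingales and Brownian Motion* (1999), Ch. IV, Thm (3.3).
-/

noncomputable section

open Set Filter MeasureTheory Complex
open _root_.Topology
open scoped NNReal ENNReal

namespace Literature.Probability.RandomPlanarGeometry

open Loewner Literature.Probability.Process Literature.Analysis.FunctionSpaces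

variable {κ : ℝ≥0} {z : ℂ}

/-- **`F(w_{t∧ρₙ})` is a martingale when `(κ/2) F'' + (4w/(1 + w²)) F' = 0`** (Schramm (2001),
proof of Thm. 2: "Note that `h(w_u)` is a local martingale … `h` satisfies
`(κ/2) h''(w) + (4w/(w² + 1)) h'(w) = 0` … Itô's formula implies that the right hand side in (3)
is a martingale"; localization `ρₙ ↑ τ(z)` as in Rohde–Schramm (2005), p. 905). Hypotheses:
`z ∈ ℍ`, `F ∈ C²` with `|F'| ≤ C₁` and the generator equation (written with a vanishing
zeroth-order term, the form of `rsObservable_itoDrift_eq_zero` with `a = 0`). Conclusion: the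
process `F(cot arg z_t)` stopped at `ρₙ = slePointLocTime κ z n` is a martingale for the raw
Brownian filtration under the pre-Wiener measure. The proof is that of
`martingale_schrammObsStopped_sle` verbatim with `schrammH` replaced by `F`.
[cite: Schramm2001Percolation, Thm. 2 (proof)] -/
theorem martingale_stoppedProcess_comp_cotArg_of_ode (hz : 0 < z.im) {F : ℝ → ℝ}
    (hcont : ContDiff ℝ 2 F) {C₁ : ℝ} (hC1 : ∀ v, |deriv F v| ≤ C₁)
    (hode : ∀ w : ℝ, (κ : ℝ) / 2 * iteratedDeriv 2 F w + 4 * w / (1 + w ^ 2) * deriv F w +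
      4 * 0 / (1 + w ^ 2) ^ 2 * F w = 0) (n : ℕ) :
    Martingale (stoppedProcess (fun t ω ↦ F (cotArg (sleDriving κ ω) z t)) (slePointLocTime κ z n))
      brownianFiltration preWienerMeasure := by
  haveI := isProbabilityMeasure_preWienerMeasure'
  set σ : (ℝ≥0 → ℝ) → WithTop ℝ≥0 := slePointLocTime κ z n with hσdef
  have hσ : IsStoppingTime brownianFiltration σ := isStoppingTime_slePointLocTime κ hz n
  have hσρ : ∀ ω, σ ω ≤ slePointLocTime κ z n ω := fun ω ↦ le_rfl
  have hσ' : ∀ t : ℝ≥0, MeasurableSet[brownianFiltration t] {ω | σ ω < t} :=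
    fun t ↦ hσ.measurableSet_lt t
  -- the processes
  set X : ℝ≥0 → (ℝ≥0 → ℝ) → ℝ := stoppedProcess (slePointRe κ z) σ with hXdef
  set Y : ℝ≥0 → (ℝ≥0 → ℝ) → ℝ := stoppedProcess (slePointIm κ z) σ with hYdef
  set A : ℝ≥0 → (ℝ≥0 → ℝ) → ℝ := fun t ω ↦ (Y t ω)⁻¹ with hAdef
  set w : ℝ≥0 → (ℝ≥0 → ℝ) → ℝ := fun t ω ↦ X t ω * A t ω with hwdef
  set h : ℝ → ℝ := F
  set σB : ℝ≥0 → (ℝ≥0 → ℝ) → ℝ := trunc σ (fun _ _ ↦ -Real.sqrt κ) with hσBdef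
  set bX : ℝ≥0 → (ℝ≥0 → ℝ) → ℝ := trunc σ (fun s ω ↦ loewnerReDrift (X s ω) (Y s ω)) with hbXdef
  set aA : ℝ≥0 → (ℝ≥0 → ℝ) → ℝ := trunc σ (fun s ω ↦ loewnerInvImDrift (X s ω) (Y s ω)) with haAdef
  set bw : ℝ≥0 → (ℝ≥0 → ℝ) → ℝ := fun t ω ↦ X t ω * aA t ω + A t ω * bX t ω with hbwdef
  set σw : ℝ≥0 → (ℝ≥0 → ℝ) → ℝ := fun t ω ↦ σB t ω * A t ω with hσwdef
  set D1 : ℝ≥0 → (ℝ≥0 → ℝ) → ℝ := fun t ω ↦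
    bw t ω * deriv h (w t ω) + 2⁻¹ * σw t ω ^ 2 * iteratedDeriv 2 h (w t ω) with hD1def
  set σG : ℝ≥0 → (ℝ≥0 → ℝ) → ℝ := fun t ω ↦ σw t ω * deriv h (w t ω) with hσGdef
  -- pathwise values and bounds
  have hYpos : ∀ t ω, 0 < Y t ω := fun t ω ↦ stoppedProcess_slePointIm_pos hz hσρ t ω
  have hYlev : ∀ t ω, z.im / (n + 2) ≤ Y t ω := fun t ω ↦ level_le_stoppedProcess_slePointIm hz hσρ t ω
  have hYle : ∀ t ω, Y t ω ≤ z.im := fun t ω ↦ stoppedProcess_slePointIm_le hz hσρ t ω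
  have hwcot : ∀ t ω, w t ω = cotArg (sleDriving κ ω) z ((min (t : WithTop ℝ≥0) (σ ω)).untopA) :=
    fun t ω ↦ by rw [← stopped_div_eq_cotArg hz hσρ t ω, div_eq_mul_inv]
  have hAbd : ∀ t ω, |A t ω| ≤ (n + 2) / z.im := fun t ω ↦ by
    simp only [hAdef]
    rw [abs_of_pos (inv_pos.2 (hYpos t ω)), inv_eq_one_div, div_le_div_iff₀ (hYpos t ω) hz, one_mul]
    have := hYlev t ω
    rw [div_le_iff₀ (by positivity : (0 : ℝ) < n + 2)] at this
    linarith
  have hσBbd : ∀ t ω, |σB t ω| ≤ Real.sqrt κ := fun t ω ↦ by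
    simp only [hσBdef, trunc_apply]
    split_ifs
    · rw [abs_neg, abs_of_nonneg (Real.sqrt_nonneg _)]
    · rw [abs_zero]; exact Real.sqrt_nonneg _
  -- derivatives of `h`
  have hc0 : Continuous h := hcont.continuous
  have hc1 : Continuous (deriv h) := hcont.continuous_deriv (by norm_num)
  -- path regularity
  have hXc : ∀ ω, Continuous (X · ω) := fun ω ↦ continuous_stoppedProcess_slePointRe hz hσρ ω
  have hYc : ∀ ω, Continuous (Y · ω) := fun ω ↦ continuous_stoppedProcess_slePointIm hz σ ω
  have hAc : ∀ ω, Continuous (A · ω) := fun ω ↦ (hYc ω).inv₀ fun t ↦ (hYpos t ω).ne'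
  have hwc : ∀ ω, Continuous (w · ω) := fun ω ↦ (hXc ω).mul (hAc ω)
  have hGc : ∀ ω, Continuous (fun t ↦ h (w t ω)) := fun ω ↦ hc0.comp (hwc ω)
  -- adaptedness and progressive measurability
  have hXa : StronglyAdapted brownianFiltration X := stronglyAdapted_stoppedProcess_slePointRe hz hσ
  have hYa : StronglyAdapted brownianFiltration Y := stronglyAdapted_stoppedProcess_slePointIm hz hσ
  have hAa : StronglyAdapted brownianFiltration A := fun t ↦ (hYa t).measurable.inv.stronglyMeasurable
  have hwa : StronglyAdapted brownianFiltration w := fun t ↦ (hXa t).mul (hAa t)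
  have hGa : StronglyAdapted brownianFiltration fun t ω ↦ h (w t ω) := fun t ↦
    hc0.comp_stronglyMeasurable (hwa t)
  have hXp : IsStronglyProgressive brownianFiltration X := hXa.isStronglyProgressive_of_continuous hXc
  have hYp : IsStronglyProgressive brownianFiltration Y := hYa.isStronglyProgressive_of_continuous hYc
  have hAp : IsStronglyProgressive brownianFiltration A := hAa.isStronglyProgressive_of_continuous hAc
  have hwp : IsStronglyProgressive brownianFiltration w := hXp.mul hAp
  have hG1p : IsStronglyProgressive brownianFiltration fun t ω ↦ deriv h (w t ω) :=
    IsStronglyProgressive.continuous_comp hwp hc1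
  have hσBp : IsStronglyProgressive brownianFiltration σB :=
    isStronglyProgressive_trunc (isStronglyProgressive_const _ _) hσ'
  have hσwp : IsStronglyProgressive brownianFiltration σw := hσBp.mul hAp
  have hσGp : IsStronglyProgressive brownianFiltration σG := hσwp.mul hG1p
  have hσwbd : ∀ t ω, |σw t ω| ≤ Real.sqrt κ * ((n + 2) / z.im) := fun t ω ↦ by
    simp only [hσwdef]; rw [abs_mul]
    exact mul_le_mul (hσBbd t ω) (hAbd t ω) (abs_nonneg _) (Real.sqrt_nonneg _)
  have hσGbd : ∀ t ω, |σG t ω| ≤ Real.sqrt κ * ((n + 2) / z.im) * C₁ := fun t ω ↦ by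
    simp only [hσGdef]; rw [abs_mul]
    exact mul_le_mul (hσwbd t ω) (hC1 _) (abs_nonneg _) (by positivity)
  ---------------------------------------------------------------------------
  -- Step 1: `x^σ` is an Itô process
  have hX : IsItoProcess X bX σB brownian brownianFiltration preWienerMeasure :=
    isItoProcess_stoppedProcess_slePointRe hz hσ hσρ
  ---------------------------------------------------------------------------
  -- Step 2: `w = x · (1/y)` is an Itô process (product rule)
  have hXbd' : ∀ t ω, |X t ω| ≤ |z.re| + (n + 2) / z.im * ((n : ℝ) + 1) + ((n : ℝ) + 1) := by
    intro t ω
    set u : ℝ≥0 := (min (t : WithTop ℝ≥0) (σ ω)).untopA with hu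
    have huloc : (u : WithTop ℝ≥0) ≤ slePointLocTime κ z n ω := coe_untopA_min_le_locTime hσρ t ω
    have hun : (u : ℝ) ≤ n + 1 := by exact_mod_cast untopA_min_le_nat_add_one hσρ t ω
    have hW : |Real.sqrt κ * brownian u ω| ≤ n + 1 := by
      rw [← sleDriving_apply]; exact abs_sleDriving_le_of_le_locTime huloc
    -- the drift integral
    have hF : ∀ r : ℝ, |loewnerReDrift (X r.toNNReal ω) (Y r.toNNReal ω)| ≤ (n + 2) / z.im := by
      intro r
      have hy := hYpos r.toNNReal ω
      have h1 : |loewnerReDrift (X r.toNNReal ω) (Y r.toNNReal ω)| ≤ (Y r.toNNReal ω)⁻¹ := by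
        have hQ : 0 < X r.toNNReal ω ^ 2 + Y r.toNNReal ω ^ 2 :=
          add_pos_of_nonneg_of_pos (sq_nonneg _) (pow_pos hy 2)
        rw [loewnerReDrift_apply, abs_div, abs_of_pos hQ, div_le_iff₀ hQ, abs_mul, abs_two,
          inv_mul_eq_div, le_div_iff₀ hy]
        nlinarith [sq_nonneg (|X r.toNNReal ω| - Y r.toNNReal ω), sq_abs (X r.toNNReal ω),
          abs_nonneg (X r.toNNReal ω)]
      refine h1.trans ?_
      rw [inv_eq_one_div, div_le_div_iff₀ hy hz, one_mul]
      have := hYlev r.toNNReal ω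
      rw [div_le_iff₀ (by positivity : (0 : ℝ) < n + 2)] at this
      linarith
    have hI : |timeIntegral bX t ω| ≤ (n + 2) / z.im * ((n : ℝ) + 1) := by
      simp only [hbXdef]
      rw [timeIntegral_trunc]
      simp only [timeIntegral, ← hu]
      have h1 := intervalIntegral.norm_integral_le_of_norm_le_const (a := (0 : ℝ)) (b := (u : ℝ))
        (f := fun r : ℝ ↦ loewnerReDrift (X r.toNNReal ω) (Y r.toNNReal ω)) (C := (n + 2) / z.im)
        fun r _ ↦ by rw [Real.norm_eq_abs]; exact hF r
      rw [Real.norm_eq_abs, sub_zero, abs_of_nonneg (NNReal.coe_nonneg u)] at h1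
      exact h1.trans (mul_le_mul_of_nonneg_left hun (by positivity))
    have hXeq := stoppedProcess_slePointRe_eq_integral hz hσρ t ω
    rw [← hu] at hXeq
    change X t ω = z.re + timeIntegral bX t ω + -Real.sqrt κ * brownian u ω at hXeq
    rw [hXeq]
    have h2 : |(-Real.sqrt κ) * brownian u ω| ≤ n + 1 := by rw [neg_mul, abs_neg]; exact hW
    calc |z.re + timeIntegral bX t ω + -Real.sqrt κ * brownian u ω|
        ≤ |z.re + timeIntegral bX t ω| + |(-Real.sqrt κ) * brownian u ω| := abs_add_le _ _
      _ ≤ (|z.re| + |timeIntegral bX t ω|) + |(-Real.sqrt κ) * brownian u ω| := by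
          gcongr; exact abs_add_le _ _
      _ ≤ |z.re| + (n + 2) / z.im * ((n : ℝ) + 1) + ((n : ℝ) + 1) := by linarith
  obtain ⟨KX, hKX, hKXM⟩ := exists_isItoIntegral_of_abs_le (hσBp.mul hXp)
    (C := Real.sqrt κ * (|z.re| + (n + 2) / z.im * ((n : ℝ) + 1) + ((n : ℝ) + 1))) fun t ω ↦ by
      rw [abs_mul]; exact mul_le_mul (hσBbd t ω) (hXbd' t ω) (abs_nonneg _) (Real.sqrt_nonneg _)
  obtain ⟨K, hK, hKM⟩ := exists_isItoIntegral_of_abs_le (hσBp.mul hAp)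
    (C := Real.sqrt κ * ((n + 2) / z.im)) fun t ω ↦ by
      rw [abs_mul]; exact mul_le_mul (hσBbd t ω) (hAbd t ω) (abs_nonneg _) (Real.sqrt_nonneg _)
  have hA0 : ∀ ω, A 0 ω = (z.im)⁻¹ := fun ω ↦ by
    simp only [hAdef, hYdef]; rw [stoppedProcess_slePointIm_zero hz]
  have hAeq : ∀ᵐ ω ∂preWienerMeasure, ∀ t : ℝ≥0, A t ω = A 0 ω + ∫ s in (0 : ℝ)..t, aA s.toNNReal ω :=
    ae_of_all _ fun ω t ↦ by
      rw [hA0]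
      exact inv_stoppedProcess_slePointIm_eq_integral hz hσρ t ω
  have haA : ∀ᵐ ω ∂preWienerMeasure, ∀ t : ℝ≥0,
      IntegrableOn (fun s : ℝ ↦ aA s.toNNReal ω) (Icc 0 t) :=
    ae_of_all _ fun ω t ↦ integrableOn_trunc_loewnerInvImDrift hz hσρ ω _ isCompact_Icc
  have hw : IsItoProcess w bw σw brownian brownianFiltration preWienerMeasure :=
    IsItoProcess.mul_timeIntegral hXa hXc hσBp hX hAa hAc hAeq haA hKX hKXM hK hKM
  ---------------------------------------------------------------------------
  -- Step 3: `h(w)` is an Itô process (Itô's formula); its drift vanishes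
  obtain ⟨Kw, hKw, hKwM⟩ := exists_isItoIntegral_of_abs_le hσGp hσGbd
  have hf' : ContDiff ℝ 2 (Function.uncurry fun (_ : ℝ) (v : ℝ) ↦ h v) := hcont.comp contDiff_snd
  have hito := ito_formula_itoProcess_ae_holds (fun (_ : ℝ) (v : ℝ) ↦ h v) hf'
    (fun t ↦ (hwa t).measurable) hσwp hw (K := Kw) (by exact hKw)
  have hdrift : ∀ s ω, D1 s ω = 0 := by
    intro s ω
    by_cases hs : (s : WithTop ℝ≥0) ≤ σ ω
    · have h1 := rsObservable_itoDrift_eq_zero κ (a := 0) (ψa := 1) (h := h) (hYpos s ω).ne'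
        (hode (X s ω * (Y s ω)⁻¹))
      simp only [hD1def, hbwdef, hσwdef, hσBdef, hbXdef, haAdef, hwdef, hAdef, trunc_of_le hs]
      simpa using h1
    · simp only [hD1def, hbwdef, hσwdef, hσBdef, hbXdef, haAdef, trunc_of_not_le hs]
      ring
  have hw0 : ∀ ω, w 0 ω = z.re / z.im := fun ω ↦ by
    simp only [hwdef, hAdef, hXdef, hYdef]
    rw [stoppedProcess_slePointRe_zero hz, stoppedProcess_slePointIm_zero hz, div_eq_mul_inv]
  have hae : ∀ᵐ ω ∂preWienerMeasure, ∀ t : ℝ≥0, h (w t ω) = h (z.re / z.im) + Kw t ω := by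
    filter_upwards [hito] with ω hω t
    have h1 := hω t
    have h2 : (fun s : ℝ ↦ deriv (fun r : ℝ ↦ h (w s.toNNReal ω)) ((s.toNNReal : ℝ≥0) : ℝ) +
        bw s.toNNReal ω * deriv (fun v ↦ h v) (w s.toNNReal ω) +
        2⁻¹ * σw s.toNNReal ω ^ 2 * iteratedDeriv 2 (fun v ↦ h v) (w s.toNNReal ω)) =
        fun _ ↦ 0 := by
      funext s
      have := hdrift s.toNNReal ω
      simp only [hD1def] at this
      simp only [deriv_const, zero_add]
      exact this
    rw [h2, intervalIntegral.integral_zero, add_zero, hw0] at h1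
    exact h1
  have hmart : Martingale (fun t ω ↦ h (w t ω)) brownianFiltration preWienerMeasure := by
    have h1 : Martingale (fun t ω ↦ h (z.re / z.im) + Kw t ω) brownianFiltration preWienerMeasure :=
      (martingale_const brownianFiltration preWienerMeasure (h (z.re / z.im))).add hKwM
    refine h1.congr hGa fun t ↦ ?_
    filter_upwards [hae] with ω hω
    exact (hω t).symm
  ---------------------------------------------------------------------------
  -- Step 4: this is the stopped process of `F(w)`
  have heq : stoppedProcess (fun t ω ↦ h (cotArg (sleDriving κ ω) z t)) σ = fun t ω ↦ h (w t ω) := by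
    funext t ω
    rw [hwcot]
    rfl
  rw [heq]
  exact hmart

end Literature.Probability.RandomPlanarGeometry

end
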